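import Literature.Combinatorics.Optimization.SmallPsdLiftExtremePoints
import Literature.Combinatorics.Optimization.BlockPsdLiftPolar
import Mathlib.Analysis.InnerProductSpace.PiL2
import Mathlib.Analysis.InnerProductSpace.Convex
import Mathlib.Analysis.Convex.StrictConvexSpace
import HarnessLib

/-!
# Second-order cones have `(S²_+)`-block lifts; single-Lorentz-cone lifts are NOT equivalent (Averkov 2019, Prop. 7)

Sources.
* G. Averkov, *Optimal size of linear matrix inequalities in semidefinite approaches to polynomial
  optimization*, SIAM J. Appl. Algebra Geom. 3 (2019) = arXiv:1806.08656 [Averkov2019], §2.1 (held text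
  `paper:arxiv-1806.08656` p05), verbatim: "The family `SDR(2)` can be characterized using the second-order
  cone `L_m := {(x_1,…,x_m) ∈ ℝ^m : x_m ≥ √(x_1² + ⋯ + x_{m−1}²)}` (for `m = 1`, we define `L_m := ℝ_+`).
  **Proposition 7** (Folklore; see the discussion in [Fawzi:2018]). For `S ⊆ ℝⁿ`, the following
  conditions are equivalent: (i) `sxd(S) ≤ 2`. (ii) `S` has an `(L_3)^m`-lift for some `m ∈ ℕ`.
  (iii) `S` has an `L_m`-lift for some `m ∈ ℕ`." Here (p03) "if `K` is a closed convex cone … and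
  `S = π(K ∩ H)`, where `H` is an affine space and `π` is a linear map, then we say that `S` has a
  `K`-lift", and `sxd(S) ≤ 2` means an `(S²_+)^m`-lift for some `m` (the tree's `HasBlockPsdLift S 2 m`).
* H. Fawzi, *On representing the positive semidefinite cone using the second-order cone*,
  Math. Program. 175 (2019) = arXiv:1610.04901 [Fawzi2016] (held text p03), verbatim:
  "`(x_1,x_2,t) ∈ Q ⟺ [[t−x_1, x_2],[x_2, t+x_1]] ⪰ 0`"; "a convex cone `K ⊂ ℝ^m` has a second-order cone
  lift of size `k` (or simply `Q^k`-lift) if … `K = π(Q^k ∩ L)` … `Q^k` is the Cartesian product of `k`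
  copies of `Q`"; "higher-dimensional second order cones … `{(x,t) : ‖x‖ ≤ t}` where `n ≥ 3` can be
  represented using the three-dimensional cone `Q`, see e.g. [BenTalNemirovski2001]".
* H. Fawzi, J. Gouveia, P. A. Parrilo, J. Saunderson, R. R. Thomas, *Lifting for simplicity*, SIAM Rev.
  64 (2022) = arXiv:2002.09788 [FawziEtAl2022Lifting], §5.1.3 (held text p25), verbatim: "The second
  order cone `𝓛^{ℓ+1}_+` has a `(S²_+)^ℓ`-lift."
* H. Fawzi, P. A. Parrilo [FawziParrilo2013] §1.2 — the tree's `posSemidef_lorentz_two_iff`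
  (`t ≥ √(x² + y²) ⟺ [[t+x, y],[y, t−x]] ⪰ 0`).

Vocabulary (tree): `secondOrderConeSet n ⊆ ℝ^{n+1}` (`Σ_{j<n} y_j² ≤ y_n²`, `y_n ≥ 0`, i.e. Averkov's
`L_{n+1}`, `SmallPsdLiftExtremePoints.lean`), `HasBlockPsdLift S d r` (`S = π((S^d_+)^r ∩ L)`,
`BlockPsdLiftFactorization.lean`). New here: `HasLorentzLift S n` (an `L_{n+1}`-lift by ONE second-order
cone, Averkov's (iii)), `lorentzPow p n = (L_{n+1})^p` and `HasLorentzPowLift S p n` (Fawzi's `Q^k`-lift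
for `n = 2`, Averkov's (ii)).

## What is PROVED (no named fact)

* §1 `S²_+ ≅ L_3`: `secondOrderConeSet_two_eq_image` / `setOf_posSemidef_two_eq_image` (the linear maps
  `vecOfSym`, `symOfVec`), `hasBlockPsdLift_secondOrderConeSet_two` (`L_3` has an `(S²_+)^1`-lift).
* §2 the Ben-Tal–Nemirovski tower `y_{n+1} ≥ √(u² + y_n²)`, `u ≥ √(y_0² + ⋯ + y_{n−1}²)`:
  `secondOrderConeSet_succ_eq_image`, and **`hasBlockPsdLift_secondOrderConeSet`:
  `L_{n+1}` has an `(S²_+)^{max(1, n−1)}`-lift**, whence the printed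
  **`hasBlockPsdLift_secondOrderConeSet_of_one_le` : an `(S²_+)^n`-lift for `n ≥ 1`**
  [FawziEtAl2022Lifting, §5.1.3] (one block better for `n ≥ 2`).
* §3 Prop. 7: **(iii) ⇒ (i)** `HasLorentzLift.hasBlockPsdLift`; **(ii) ⇒ (i)**
  `HasLorentzPowLift.hasBlockPsdLift` (through `hasBlockPsdLift_lorentzPow`: `(L_{n+1})^p` has an
  `(S²_+)^{p·max(1,n−1)}`-lift); **(i) ⇒ (ii)** `HasBlockPsdLift.hasLorentzPowLift_two`; so
  **(i) ⟺ (ii)** with the same number of cones/blocks, `Averkov2019_prop7_i_iff_ii`, and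
  `Averkov2019_prop7_iii_imp_i`.
* §4 **(i) ⇒ (iii) is FALSE as printed**: the nonnegative orthant `ℝ³_+` has `sxd = 1 ≤ 2`
  (`hasBlockPsdLift_orthantThree`) but NO lift by a single second-order cone of any dimension
  (`not_hasLorentzLift_orthantThree`), hence `Averkov2019_prop7_iii_false`. Mechanism: if
  `ℝ³_+ = π(L ∩ A)`, a point `q ∈ L ∩ A` mapped to the facet `{x_0 = 0}` cannot be an interior point of
  `L` (moving `q` inside `A` away from a preimage of `(1,1,1)` would leave the orthant), so the preimages
  of `e_1`, `e_2` and of their midpoint all lie on `∂L`; strict convexity of the Euclidean norm then puts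
  the preimages of `e_1`, `e_2` on one ray of `L`, and `π` of a ray cannot contain two independent
  vectors. (Equivalently: proper faces of an affine slice of one Lorentz cone have dimension `≤ 1`,
  while a `K`-lift of `ℝ³_+` needs a face mapping onto a `2`-dimensional facet.) The correct third
  condition is Fawzi's: a lift by a finite PRODUCT of second-order cones (`HasLorentzPowLift`, §3), and
  with that reading all three conditions are equivalent (§3). Averkov's paper uses only (i) ⟺ (ii).

presearch (2026-08-29): the tower and `Q ≅ S²_+` → [corpus: paper:arxiv-2002.09788 p25 "(S²_+)^ℓ-lift";
paper:arxiv-1610.04901 p03; tree `posSemidef_lorentz_two_iff`]; "no lift of the orthant / of a product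
by a SINGLE second-order cone" → none found stated (corpus `lit search --hybrid` "lift by a single
second-order cone … product of second-order cones representable set": generic SOCP textbook hits; galaxy
`second-order cone lift|Lorentz cone lift|single second-order cone`, all stars: 9 rows, none relevant) —
an elementary observation recorded here because the printed Prop. 7 (iii) asserts the opposite.

Label: literature typing / erratum. No psd-rank content for the matching polytope beyond vocabulary; no
P-vs-NP content. No sorry, no new `Prop` fact.
-/

noncomputable section

open Matrix Finset
open scoped MatrixOrder

namespace Literature.Combinatorics.Optimization

namespace SecondOrderConeLift

/-! ### §1 `S²_+ ≅ L_3` -/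

/-- `v = (x₁, x₂, t) ↦ [[t + x₁, x₂],[x₂, t − x₁]]` (Fawzi's identification of `Q` with `S²_+`, up to the
sign of `x₁`). [cite: Fawzi2016, §1 (p03, "(x_1,x_2,t) ∈ Q ⟺ [[t−x_1, x_2],[x_2, t+x_1]] ⪰ 0")]
[cite: FawziParrilo2013, §1.2 (p. 4)] -/
def symOfVec : (Fin 3 → ℝ) →ₗ[ℝ] Matrix (Fin 2) (Fin 2) ℝ where
  toFun v := !![v 2 + v 0, v 1; v 1, v 2 - v 0]
  map_add' v w := by
    ext i j
    fin_cases i <;> fin_cases j <;> simp <;> ring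
  map_smul' c v := by
    ext i j
    fin_cases i <;> fin_cases j <;> simp <;> ring

/-- The inverse on symmetric matrices: `M ↦ ((M₀₀ − M₁₁)/2, M₀₁, (M₀₀ + M₁₁)/2)`. [cite: Fawzi2016, §1 (p03)] -/
def vecOfSym : Matrix (Fin 2) (Fin 2) ℝ →ₗ[ℝ] (Fin 3 → ℝ) where
  toFun M := ![(M 0 0 - M 1 1) / 2, M 0 1, (M 0 0 + M 1 1) / 2]
  map_add' M N := by
    funext i
    fin_cases i <;> simp <;> ring
  map_smul' c M := by
    funext i
    fin_cases i <;> simp <;> ring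

/-- Unfolding of `symOfVec`. [cite: Fawzi2016, §1 (p03)] -/
theorem symOfVec_apply (v : Fin 3 → ℝ) : symOfVec v = !![v 2 + v 0, v 1; v 1, v 2 - v 0] := rfl

/-- Unfolding of `vecOfSym`. [cite: Fawzi2016, §1 (p03)] -/
theorem vecOfSym_apply (M : Matrix (Fin 2) (Fin 2) ℝ) :
    vecOfSym M = ![(M 0 0 - M 1 1) / 2, M 0 1, (M 0 0 + M 1 1) / 2] := rfl

/-- `vecOfSym ∘ symOfVec = id`. [cite: Fawzi2016, §1 (p03)] -/
theorem vecOfSym_symOfVec (v : Fin 3 → ℝ) : vecOfSym (symOfVec v) = v := by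
  rw [symOfVec_apply, vecOfSym_apply]
  funext i
  fin_cases i <;> simp

/-- `symOfVec ∘ vecOfSym = id` on symmetric matrices. [cite: Fawzi2016, §1 (p03)] -/
theorem symOfVec_vecOfSym {M : Matrix (Fin 2) (Fin 2) ℝ} (hM : M 1 0 = M 0 1) :
    symOfVec (vecOfSym M) = M := by
  rw [vecOfSym_apply, symOfVec_apply]
  ext i j
  fin_cases i <;> fin_cases j <;> simp [hM] <;> ring

/-- Membership in `L_3` in the `√` form. [cite: Averkov2019, §2.1 (p05, definition of `L_m`)] -/
theorem mem_secondOrderConeSet_two_iff (v : Fin 3 → ℝ) :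
    v ∈ secondOrderConeSet 2 ↔ Real.sqrt (v 0 ^ 2 + v 1 ^ 2) ≤ v 2 := by
  rw [mem_secondOrderConeSet_iff, Real.sqrt_le_iff, Fin.sum_univ_two]
  have h0 : (Fin.castSucc (0 : Fin 2) : Fin 3) = 0 := rfl
  have h1 : (Fin.castSucc (1 : Fin 2) : Fin 3) = 1 := rfl
  have h2 : (Fin.last 2 : Fin 3) = 2 := rfl
  rw [h0, h1, h2]
  exact and_comm

/-- **`[[t + x₁, x₂],[x₂, t − x₁]] ⪰ 0 ⟺ (x₁, x₂, t) ∈ L_3`.** [cite: Fawzi2016, §1 (p03)] [cite: FawziParrilo2013, §1.2 (p. 4)] -/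
theorem posSemidef_symOfVec_iff (v : Fin 3 → ℝ) : (symOfVec v).PosSemidef ↔ v ∈ secondOrderConeSet 2 := by
  rw [mem_secondOrderConeSet_two_iff, symOfVec_apply]
  exact posSemidef_lorentz_two_iff (v 2) (v 0) (v 1)

/-- A psd real `2 × 2` matrix is symmetric. [folklore] -/
private theorem apply_one_zero_eq_of_posSemidef {M : Matrix (Fin 2) (Fin 2) ℝ} (hM : M.PosSemidef) :
    M 1 0 = M 0 1 := by
  have h := hM.1.apply 1 0
  rw [star_trivial] at h
  exact h.symm

/-- **`L_3` is the linear image of `S²_+`** under `vecOfSym`. [cite: Fawzi2016, §1 (p03)] -/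
theorem secondOrderConeSet_two_eq_image :
    secondOrderConeSet 2 = vecOfSym '' {M : Matrix (Fin 2) (Fin 2) ℝ | M.PosSemidef} := by
  ext v
  constructor
  · intro hv
    exact ⟨symOfVec v, (posSemidef_symOfVec_iff v).2 hv, vecOfSym_symOfVec v⟩
  · rintro ⟨M, hM, rfl⟩
    rw [← posSemidef_symOfVec_iff, symOfVec_vecOfSym (apply_one_zero_eq_of_posSemidef hM)]
    exact hM

/-- **`S²_+` is the linear image of `L_3`** under `symOfVec`. [cite: Fawzi2016, §1 (p03)] -/
theorem setOf_posSemidef_two_eq_image :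
    {M : Matrix (Fin 2) (Fin 2) ℝ | M.PosSemidef} = symOfVec '' secondOrderConeSet 2 := by
  ext M
  constructor
  · intro hM
    exact ⟨vecOfSym M, by rw [← posSemidef_symOfVec_iff, symOfVec_vecOfSym
      (apply_one_zero_eq_of_posSemidef hM)]; exact hM,
      symOfVec_vecOfSym (apply_one_zero_eq_of_posSemidef hM)⟩
  · rintro ⟨v, hv, rfl⟩
    exact (posSemidef_symOfVec_iff v).2 hv

/-- **`L_3` has an `(S²_+)^1`-lift** (it IS `S²_+` up to a linear isomorphism). [cite: Fawzi2016, §1 (p03)]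
[cite: FawziEtAl2022Lifting, §5.1.3 (p25)] -/
theorem hasBlockPsdLift_secondOrderConeSet_two : HasBlockPsdLift (secondOrderConeSet 2) 2 1 := by
  rw [hasBlockPsdLift_one_iff]
  refine ⟨⊤, vecOfSym, ?_⟩
  rw [secondOrderConeSet_two_eq_image]
  congr 1
  ext M
  simp only [Set.mem_setOf_eq, AffineSubspace.mem_top, and_true]

/-! ### §2 The tower: `L_{n+2} = π((L_{n+1} × L_3) ∩ {y_n = v_0})` -/

variable {n : ℕ}

/-- The head `(y_0, …, y_{n−1})` of `y ∈ ℝ^{n+1}` as a Euclidean vector. [folklore] -/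
def hd (y : Fin (n + 1) → ℝ) : EuclideanSpace ℝ (Fin n) := WithLp.toLp 2 fun j => y (Fin.castSucc j)

/-- Coordinates of the head. [folklore] -/
private theorem hd_apply (y : Fin (n + 1) → ℝ) (j : Fin n) : hd y j = y (Fin.castSucc j) := rfl

/-- `‖hd y‖² = Σ_{j<n} y_j²`. [folklore] -/
private theorem norm_hd_sq (y : Fin (n + 1) → ℝ) : ‖hd y‖ ^ 2 = ∑ j : Fin n, y (Fin.castSucc j) ^ 2 := by
  rw [EuclideanSpace.real_norm_sq_eq]
  rfl

/-- **`y ∈ L_{n+1} ⟺ ‖(y_0,…,y_{n−1})‖ ≤ y_n`.** [cite: Averkov2019, §2.1 (p05, definition of `L_m`)] -/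
theorem mem_secondOrderConeSet_iff_norm_hd (y : Fin (n + 1) → ℝ) :
    y ∈ secondOrderConeSet n ↔ ‖hd y‖ ≤ y (Fin.last n) := by
  rw [mem_secondOrderConeSet_iff, ← norm_hd_sq]
  constructor
  · rintro ⟨h1, h2⟩
    exact le_of_sq_le_sq h1 h2
  · intro h
    exact ⟨pow_le_pow_left₀ (norm_nonneg _) h 2, (norm_nonneg _).trans h⟩

variable (n) in
/-- The gluing map `((y_0,…,y_n), (v_0,v_1,v_2)) ↦ (y_0,…,y_{n−1}, v_1, v_2)`. [folklore] -/
def glue : ((Fin (n + 1) → ℝ) × (Fin 3 → ℝ)) →ₗ[ℝ] (Fin (n + 2) → ℝ) where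
  toFun p := fun i => if h : (i : ℕ) < n then p.1 ⟨i, by omega⟩ else if (i : ℕ) = n then p.2 1 else p.2 2
  map_add' p q := by
    funext i
    simp only [Prod.fst_add, Prod.snd_add, Pi.add_apply]
    split_ifs <;> rfl
  map_smul' c p := by
    funext i
    simp only [Prod.smul_fst, Prod.smul_snd, Pi.smul_apply, RingHom.id_apply]
    split_ifs <;> rfl

/-- `glue` on the first `n` coordinates. [folklore] -/
private theorem glue_castSucc_castSucc (p : (Fin (n + 1) → ℝ) × (Fin 3 → ℝ)) (j : Fin n) :
    glue n p (Fin.castSucc (Fin.castSucc j)) = p.1 (Fin.castSucc j) := by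
  change (if h : ((Fin.castSucc (Fin.castSucc j) : Fin (n + 2)) : ℕ) < n then _ else _) = _
  have hj : ((Fin.castSucc (Fin.castSucc j) : Fin (n + 2)) : ℕ) < n := by simp
  rw [dif_pos hj]
  rfl

/-- `glue` on coordinate `n`. [folklore] -/
private theorem glue_castSucc_last (p : (Fin (n + 1) → ℝ) × (Fin 3 → ℝ)) :
    glue n p (Fin.castSucc (Fin.last n)) = p.2 1 := by
  change (if h : ((Fin.castSucc (Fin.last n) : Fin (n + 2)) : ℕ) < n then _ else _) = _
  have h1 : ¬ ((Fin.castSucc (Fin.last n) : Fin (n + 2)) : ℕ) < n := by simp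
  have h2 : ((Fin.castSucc (Fin.last n) : Fin (n + 2)) : ℕ) = n := by simp
  rw [dif_neg h1, if_pos h2]

/-- `glue` on the last coordinate. [folklore] -/
private theorem glue_last (p : (Fin (n + 1) → ℝ) × (Fin 3 → ℝ)) : glue n p (Fin.last (n + 1)) = p.2 2 := by
  change (if h : ((Fin.last (n + 1) : Fin (n + 2)) : ℕ) < n then _ else _) = _
  have h1 : ¬ ((Fin.last (n + 1) : Fin (n + 2)) : ℕ) < n := by simp
  have h2 : ¬ ((Fin.last (n + 1) : Fin (n + 2)) : ℕ) = n := by simp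
  rw [dif_neg h1, if_neg h2]

variable (n) in
/-- **The Ben-Tal–Nemirovski tower step**: `L_{n+2}` is the image under `glue` of
`(L_{n+1} × L_3) ∩ {y_n = v_0}` — "`y_{n+1} ≥ √(u² + y_n²)`, `u ≥ √(y_0² + ⋯ + y_{n−1}²)`".
[cite: Fawzi2016, §1 (p03, "higher-dimensional second order cones … can be represented using the three-dimensional cone Q")]
[cite: BenTalNemirovski2001, §2 (tower of quadratic constraints)] -/
theorem secondOrderConeSet_succ_eq_image :
    secondOrderConeSet (n + 1) =
      glue n '' ((secondOrderConeSet n ×ˢ secondOrderConeSet 2) ∩ {p | p.1 (Fin.last n) = p.2 0}) := by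
  ext w
  constructor
  · intro hw
    rw [mem_secondOrderConeSet_iff, Fin.sum_univ_castSucc] at hw
    obtain ⟨hw1, hw2⟩ := hw
    -- `u = √(Σ_{j<n} w_j²)`
    set s : ℝ := ∑ j : Fin n, w (Fin.castSucc (Fin.castSucc j)) ^ 2 with hs
    have hs0 : 0 ≤ s := Finset.sum_nonneg fun j _ => sq_nonneg _
    set u : ℝ := Real.sqrt s with hu
    have hu0 : 0 ≤ u := Real.sqrt_nonneg _
    have hu2 : u ^ 2 = s := Real.sq_sqrt hs0
    let y : Fin (n + 1) → ℝ := Fin.snoc (fun j => w (Fin.castSucc (Fin.castSucc j))) u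
    let v : Fin 3 → ℝ := ![u, w (Fin.castSucc (Fin.last n)), w (Fin.last (n + 1))]
    have hy : ∀ j : Fin n, y (Fin.castSucc j) = w (Fin.castSucc (Fin.castSucc j)) := fun j => by
      simp [y]
    have hyl : y (Fin.last n) = u := by simp [y]
    refine ⟨(y, v), ⟨⟨?_, ?_⟩, ?_⟩, ?_⟩
    · change y ∈ secondOrderConeSet n
      rw [mem_secondOrderConeSet_iff]
      refine ⟨?_, by rw [hyl]; exact hu0⟩
      rw [hyl, hu2, hs]
      exact le_of_eq (Finset.sum_congr rfl fun j _ => by rw [hy])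
    · change v ∈ secondOrderConeSet 2
      rw [mem_secondOrderConeSet_iff, Fin.sum_univ_two]
      change u ^ 2 + w (Fin.castSucc (Fin.last n)) ^ 2 ≤ w (Fin.last (n + 1)) ^ 2 ∧
        0 ≤ w (Fin.last (n + 1))
      rw [hu2]
      exact ⟨hw1, hw2⟩
    · change y (Fin.last n) = v 0
      rw [hyl]
      rfl
    · funext i
      refine Fin.lastCases ?_ (fun i' => ?_) i
      · rw [glue_last]; rfl
      · refine Fin.lastCases ?_ (fun j => ?_) i'
        · rw [glue_castSucc_last]; rfl
        · rw [glue_castSucc_castSucc]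
          exact hy j
  · rintro ⟨⟨y, v⟩, ⟨⟨hy, hv⟩, hyv⟩, rfl⟩
    change y (Fin.last n) = v 0 at hyv
    change y ∈ secondOrderConeSet n at hy
    change v ∈ secondOrderConeSet 2 at hv
    rw [mem_secondOrderConeSet_iff] at hy hv ⊢
    rw [Fin.sum_univ_two] at hv
    have e0 : (Fin.castSucc (0 : Fin 2) : Fin 3) = 0 := rfl
    have e1 : (Fin.castSucc (1 : Fin 2) : Fin 3) = 1 := rfl
    have e2 : (Fin.last 2 : Fin 3) = 2 := rfl
    rw [e0, e1, e2] at hv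
    rw [Fin.sum_univ_castSucc, glue_last, glue_castSucc_last]
    simp only [glue_castSucc_castSucc]
    refine ⟨?_, hv.2⟩
    have h1 := hy.1
    rw [hyv] at h1
    linarith [hv.1]

variable (n) in
/-- The constraint `y_n = v_0` as an affine subspace. [folklore] -/
private def glueDiag : AffineSubspace ℝ ((Fin (n + 1) → ℝ) × (Fin 3 → ℝ)) :=
  (LinearMap.ker ((LinearMap.proj (Fin.last n)).comp (LinearMap.fst ℝ (Fin (n + 1) → ℝ) (Fin 3 → ℝ)) -
    (LinearMap.proj (0 : Fin 3)).comp (LinearMap.snd ℝ (Fin (n + 1) → ℝ) (Fin 3 → ℝ)))).toAffineSubspace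

/-- Membership in `glueDiag`. [folklore] -/
private theorem mem_glueDiag (p : (Fin (n + 1) → ℝ) × (Fin 3 → ℝ)) :
    p ∈ (glueDiag n : Set ((Fin (n + 1) → ℝ) × (Fin 3 → ℝ))) ↔ p.1 (Fin.last n) = p.2 0 := by
  change p ∈ glueDiag n ↔ _
  rw [glueDiag, Submodule.mem_toAffineSubspace, LinearMap.mem_ker, LinearMap.sub_apply, sub_eq_zero]
  rfl

/-- **Tower step for lifts**: an `(S²_+)^r`-lift of `L_{n+1}` gives an `(S²_+)^{r+1}`-lift of `L_{n+2}`.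
[cite: FawziEtAl2022Lifting, §5.1.3 (p25)] [cite: BenTalNemirovski2001, §2] -/
theorem hasBlockPsdLift_secondOrderConeSet_succ {r : ℕ} (h : HasBlockPsdLift (secondOrderConeSet n) 2 r) :
    HasBlockPsdLift (secondOrderConeSet (n + 1)) 2 (r + 1) := by
  have h' := ((h.prod hasBlockPsdLift_secondOrderConeSet_two).inter_affineSubspace (glueDiag n)).image
    (glue n)
  have hset : (secondOrderConeSet n ×ˢ secondOrderConeSet 2) ∩ (glueDiag n : Set _) =
      (secondOrderConeSet n ×ˢ secondOrderConeSet 2) ∩ {p | p.1 (Fin.last n) = p.2 0} := by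
    ext p
    rw [Set.mem_inter_iff, Set.mem_inter_iff, mem_glueDiag]
    rfl
  rw [hset, ← secondOrderConeSet_succ_eq_image] at h'
  exact h'

/-- `L_2 = {(a, t) : |a| ≤ t}` is the image of the slice `v_1 = 0` of `L_3`. [cite: Averkov2019, §2.1 (p05)] -/
theorem secondOrderConeSet_one_eq_image :
    secondOrderConeSet 1 =
      (LinearMap.pi fun i : Fin 2 => LinearMap.proj (![0, 2] i) : (Fin 3 → ℝ) →ₗ[ℝ] (Fin 2 → ℝ)) ''
        (secondOrderConeSet 2 ∩ {v | v 1 = 0}) := by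
  ext w
  simp only [Set.mem_image, Set.mem_inter_iff, Set.mem_setOf_eq, mem_secondOrderConeSet_iff,
    Fin.sum_univ_one, Fin.sum_univ_two]
  have e10 : (Fin.castSucc (0 : Fin 1) : Fin 2) = 0 := rfl
  have e11 : (Fin.last 1 : Fin 2) = 1 := rfl
  have e0 : (Fin.castSucc (0 : Fin 2) : Fin 3) = 0 := rfl
  have e1 : (Fin.castSucc (1 : Fin 2) : Fin 3) = 1 := rfl
  have e2 : (Fin.last 2 : Fin 3) = 2 := rfl
  rw [e10, e11, e0, e1, e2]
  constructor
  · rintro ⟨h1, h2⟩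
    refine ⟨![w 0, 0, w 1], ⟨⟨by simpa using h1, by simpa using h2⟩, rfl⟩, ?_⟩
    funext i
    fin_cases i <;> rfl
  · rintro ⟨v, ⟨⟨h1, h2⟩, hv1⟩, rfl⟩
    rw [hv1] at h1
    simp only [LinearMap.pi_apply, LinearMap.coe_proj, Function.eval, Matrix.cons_val_zero,
      Matrix.cons_val_one]
    constructor <;> nlinarith

/-- `L_1 = ℝ_+` is the image of `L_3` under the last coordinate. [cite: Averkov2019, §2.1 (p05, "for m = 1 we define L_m := ℝ_+")] -/
theorem secondOrderConeSet_zero_eq_image :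
    secondOrderConeSet 0 =
      (LinearMap.pi fun _ : Fin 1 => LinearMap.proj (2 : Fin 3) : (Fin 3 → ℝ) →ₗ[ℝ] (Fin 1 → ℝ)) ''
        secondOrderConeSet 2 := by
  ext w
  simp only [Set.mem_image, mem_secondOrderConeSet_iff, Finset.univ_eq_empty, Finset.sum_empty,
    Fin.sum_univ_two]
  have e00 : (Fin.last 0 : Fin 1) = 0 := rfl
  have e0 : (Fin.castSucc (0 : Fin 2) : Fin 3) = 0 := rfl
  have e1 : (Fin.castSucc (1 : Fin 2) : Fin 3) = 1 := rfl
  have e2 : (Fin.last 2 : Fin 3) = 2 := rfl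
  rw [e00, e0, e1, e2]
  constructor
  · rintro ⟨-, h2⟩
    refine ⟨![0, 0, w 0], ⟨by simpa using sq_nonneg (w 0), by simpa using h2⟩, ?_⟩
    funext i
    fin_cases i
    rfl
  · rintro ⟨v, ⟨h1, h2⟩, rfl⟩
    simp only [LinearMap.pi_apply, LinearMap.coe_proj, Function.eval]
    exact ⟨sq_nonneg _, h2⟩

/-- `L_2` has an `(S²_+)^1`-lift. [cite: FawziEtAl2022Lifting, §5.1.3 (p25)] -/
theorem hasBlockPsdLift_secondOrderConeSet_one : HasBlockPsdLift (secondOrderConeSet 1) 2 1 := by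
  let S : AffineSubspace ℝ (Fin 3 → ℝ) := (LinearMap.ker (LinearMap.proj (1 : Fin 3))).toAffineSubspace
  have hS : (S : Set (Fin 3 → ℝ)) = {v | v 1 = 0} := by
    ext v
    change v ∈ S ↔ _
    rw [Submodule.mem_toAffineSubspace, LinearMap.mem_ker]
    rfl
  have h := (hasBlockPsdLift_secondOrderConeSet_two.inter_affineSubspace S).image
    (LinearMap.pi fun i : Fin 2 => LinearMap.proj (![0, 2] i) : (Fin 3 → ℝ) →ₗ[ℝ] (Fin 2 → ℝ))
  rw [hS, ← secondOrderConeSet_one_eq_image] at h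
  exact h

/-- `L_1 = ℝ_+` has an `(S²_+)^1`-lift. [cite: FawziEtAl2022Lifting, §5.1.3 (p25)] -/
theorem hasBlockPsdLift_secondOrderConeSet_zero : HasBlockPsdLift (secondOrderConeSet 0) 2 1 := by
  have h := hasBlockPsdLift_secondOrderConeSet_two.image
    (LinearMap.pi fun _ : Fin 1 => LinearMap.proj (2 : Fin 3) : (Fin 3 → ℝ) →ₗ[ℝ] (Fin 1 → ℝ))
  rw [← secondOrderConeSet_zero_eq_image] at h
  exact h

variable (n) in
/-- **Second-order cones have `sxd ≤ 2`: `L_{n+1}` has an `(S²_+)^{max(1, n−1)}`-lift** (the tower of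
`n − 1` three-dimensional cones for `n ≥ 2`). [cite: FawziEtAl2022Lifting, §5.1.3 (p25)]
[cite: Fawzi2016, §1 (p03)] [cite: BenTalNemirovski2001, §2] -/
theorem hasBlockPsdLift_secondOrderConeSet : HasBlockPsdLift (secondOrderConeSet n) 2 (max 1 (n - 1)) := by
  rcases Nat.lt_or_ge n 2 with hn | hn
  · interval_cases n
    · exact hasBlockPsdLift_secondOrderConeSet_zero
    · exact hasBlockPsdLift_secondOrderConeSet_one
  · rw [max_eq_right (by omega)]
    induction n, hn using Nat.le_induction with
    | base => exact hasBlockPsdLift_secondOrderConeSet_two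
    | succ m hm ih =>
      have h := hasBlockPsdLift_secondOrderConeSet_succ ih
      rwa [show m - 1 + 1 = m + 1 - 1 by omega] at h

/-- **"The second order cone `𝓛^{ℓ+1}_+` has a `(S²_+)^ℓ`-lift"** (verbatim, `ℓ = n ≥ 1`).
[cite: FawziEtAl2022Lifting, §5.1.3 (p25)] -/
theorem hasBlockPsdLift_secondOrderConeSet_of_one_le (hn : 1 ≤ n) :
    HasBlockPsdLift (secondOrderConeSet n) 2 n :=
  (hasBlockPsdLift_secondOrderConeSet n).mono_blocks (by omega)

/-! ### §3 Lifts by second-order cones (Averkov 2019, Prop. 7) -/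

/-- **`L_{n+1}`-lift** of a set `S`: `S = π(L_{n+1} ∩ A)` for an affine subspace `A` and a linear map `π`
— a lift by a SINGLE second-order cone, condition (iii) of Averkov's Proposition 7.
[cite: Averkov2019, §1.1 (p03, "S has a K-lift") and Prop. 7 (iii) (p05)] -/
def HasLorentzLift {E : Type*} [AddCommGroup E] [Module ℝ E] (S : Set E) (n : ℕ) : Prop :=
  ∃ (A : AffineSubspace ℝ (Fin (n + 1) → ℝ)) (π : (Fin (n + 1) → ℝ) →ₗ[ℝ] E),
    S = π '' (secondOrderConeSet n ∩ (A : Set (Fin (n + 1) → ℝ)))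

/-- The product cone `(L_{n+1})^p` (Fawzi's `Q^k` for `n = 2`, `p = k`). [cite: Fawzi2016, §1 (p03, "Q^k = Q × ⋯ × Q (k copies)")] -/
def lorentzPow (p n : ℕ) : Set (Fin p → (Fin (n + 1) → ℝ)) := {z | ∀ i, z i ∈ secondOrderConeSet n}

/-- **`(L_{n+1})^p`-lift** of a set `S` (Fawzi's "second-order cone lift of size `p`" for `n = 2`;
condition (ii) of Averkov's Proposition 7 for `n = 2`). [cite: Fawzi2016, §1 (p03, "Q^k-lift")]
[cite: Averkov2019, Prop. 7 (ii) (p05)] -/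
def HasLorentzPowLift {E : Type*} [AddCommGroup E] [Module ℝ E] (S : Set E) (p n : ℕ) : Prop :=
  ∃ (A : AffineSubspace ℝ (Fin p → (Fin (n + 1) → ℝ))) (π : (Fin p → (Fin (n + 1) → ℝ)) →ₗ[ℝ] E),
    S = π '' (lorentzPow p n ∩ (A : Set (Fin p → (Fin (n + 1) → ℝ))))

/-- **Prop. 7, (iii) ⇒ (i)**: an `L_{n+1}`-lift gives an `(S²_+)^{max(1,n−1)}`-lift (`sxd ≤ 2`).
[cite: Averkov2019, Prop. 7 (p05)] -/
theorem HasLorentzLift.hasBlockPsdLift {E : Type*} [AddCommGroup E] [Module ℝ E] {S : Set E}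
    (h : HasLorentzLift S n) : HasBlockPsdLift S 2 (max 1 (n - 1)) := by
  obtain ⟨A, π, rfl⟩ := h
  exact ((hasBlockPsdLift_secondOrderConeSet n).inter_affineSubspace A).image π

/-- Appending one factor: `(Fin p → X) × X → (Fin (p+1) → X)`, `(z, x) ↦ (z_0,…,z_{p−1}, x)`. [folklore] -/
def snocMap (p : ℕ) (X : Type*) [AddCommGroup X] [Module ℝ X] : ((Fin p → X) × X) →ₗ[ℝ] (Fin (p + 1) → X) where
  toFun q := Fin.snoc q.1 q.2
  map_add' q q' := by
    funext i
    refine Fin.lastCases ?_ (fun j => ?_) i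
    · simp only [Fin.snoc_last, Prod.fst_add, Prod.snd_add, Pi.add_apply]
    · simp only [Fin.snoc_castSucc, Prod.fst_add, Prod.snd_add, Pi.add_apply]
  map_smul' c q := by
    funext i
    refine Fin.lastCases ?_ (fun j => ?_) i
    · simp only [Fin.snoc_last, Prod.smul_fst, Prod.smul_snd, Pi.smul_apply, RingHom.id_apply]
    · simp only [Fin.snoc_castSucc, Prod.smul_fst, Prod.smul_snd, Pi.smul_apply, RingHom.id_apply]

/-- `(L_{n+1})^{p+1} = snocMap((L_{n+1})^p × L_{n+1})` (the `(p+1)`-fold product from the `p`-fold one).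
[cite: Fawzi2016, §1 (p03, "Q^k = Q × ⋯ × Q (k copies)")] -/
theorem lorentzPow_succ_eq_image (p n : ℕ) :
    lorentzPow (p + 1) n = snocMap p (Fin (n + 1) → ℝ) '' (lorentzPow p n ×ˢ secondOrderConeSet n) := by
  ext w
  constructor
  · intro hw
    refine ⟨(Fin.init w, w (Fin.last p)), ⟨fun i => hw _, hw _⟩, ?_⟩
    exact Fin.snoc_init_self w
  · rintro ⟨⟨z, x⟩, ⟨hz, hx⟩, rfl⟩
    intro i
    change (Fin.snoc (α := fun _ => Fin (n + 1) → ℝ) z x) i ∈ secondOrderConeSet n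
    refine Fin.lastCases ?_ (fun j => ?_) i
    · rw [Fin.snoc_last]; exact hx
    · rw [Fin.snoc_castSucc]; exact hz j

/-- **`(L_{n+1})^p` has an `(S²_+)^{p · max(1, n−1)}`-lift** (in particular Fawzi's `Q^p = (L_3)^p` has an
`(S²_+)^p`-lift). [cite: Fawzi2016, §1 (p03)] [cite: Averkov2019, Prop. 7 (p05)] -/
theorem hasBlockPsdLift_lorentzPow (p n : ℕ) : HasBlockPsdLift (lorentzPow p n) 2 (p * max 1 (n - 1)) := by
  induction p with
  | zero =>
    have h0 : lorentzPow 0 n = {0} := by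
      ext z
      simp only [lorentzPow, Set.mem_setOf_eq, Set.mem_singleton_iff, IsEmpty.forall_iff, true_iff]
      exact Subsingleton.elim _ _
    rw [h0, Nat.zero_mul]
    exact hasBlockPsdLift_zero_singleton 2 0
  | succ p ih =>
    have h := (ih.prod (hasBlockPsdLift_secondOrderConeSet n)).image (snocMap p (Fin (n + 1) → ℝ))
    rw [← lorentzPow_succ_eq_image] at h
    rwa [Nat.succ_mul]

/-- **Prop. 7, (ii) ⇒ (i)**: an `(L_{n+1})^p`-lift gives an `(S²_+)^{p·max(1,n−1)}`-lift; for `n = 2`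
(Fawzi's `Q^p`): `p` blocks. [cite: Averkov2019, Prop. 7 (p05)] [cite: Fawzi2016, §1 (p03)] -/
theorem HasLorentzPowLift.hasBlockPsdLift {E : Type*} [AddCommGroup E] [Module ℝ E] {S : Set E} {p : ℕ}
    (h : HasLorentzPowLift S p n) : HasBlockPsdLift S 2 (p * max 1 (n - 1)) := by
  obtain ⟨A, π, rfl⟩ := h
  exact ((hasBlockPsdLift_lorentzPow p n).inter_affineSubspace A).image π

/-- **Prop. 7, (i) ⇒ (ii)**: an `(S²_+)^p`-lift is a `Q^p = (L_3)^p`-lift (replace each `2 × 2` block by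
its Lorentz coordinates `symOfVec`). [cite: Averkov2019, Prop. 7 (p05)] [cite: Fawzi2016, §1 (p03)] -/
theorem _root_.Literature.Combinatorics.Optimization.HasBlockPsdLift.hasLorentzPowLift_two {E : Type*}
    [AddCommGroup E] [Module ℝ E] {S : Set E} {p : ℕ} (h : HasBlockPsdLift S 2 p) :
    HasLorentzPowLift S p 2 := by
  obtain ⟨L, π, rfl⟩ := h
  let sv : (Fin p → (Fin 3 → ℝ)) →ₗ[ℝ] (Fin p → Matrix (Fin 2) (Fin 2) ℝ) := symOfVec.compLeft (Fin p)
  have hsv : ∀ z i, sv z i = symOfVec (z i) := fun z i => rfl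
  refine ⟨L.comap sv.toAffineMap, π ∘ₗ sv, ?_⟩
  ext y
  constructor
  · rintro ⟨M, ⟨hM, hML⟩, rfl⟩
    have hsym : ∀ i, M i 1 0 = M i 0 1 := fun i => apply_one_zero_eq_of_posSemidef (hM i)
    have hz : sv (fun i => vecOfSym (M i)) = M := by
      funext i
      rw [hsv, symOfVec_vecOfSym (hsym i)]
    refine ⟨fun i => vecOfSym (M i), ⟨fun i => ?_, ?_⟩, ?_⟩
    · rw [← posSemidef_symOfVec_iff, symOfVec_vecOfSym (hsym i)]
      exact hM i
    · exact AffineSubspace.mem_comap.2 (by change sv (fun i => vecOfSym (M i)) ∈ L; rw [hz]; exact hML)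
    · change π (sv (fun i => vecOfSym (M i))) = π M
      rw [hz]
  · rintro ⟨z, ⟨hz, hzL⟩, rfl⟩
    refine ⟨sv z, ⟨fun i => ?_, AffineSubspace.mem_comap.1 hzL⟩, rfl⟩
    rw [hsv, posSemidef_symOfVec_iff]
    exact hz i

/-- **Averkov 2019, Proposition 7, (i) ⟺ (ii)**, with matching counts: `S` has an `(S²_+)^m`-lift iff it
has an `(L_3)^m`-lift. [cite: Averkov2019, Prop. 7 (p05)] -/
theorem Averkov2019_prop7_i_iff_ii {E : Type*} [AddCommGroup E] [Module ℝ E] (S : Set E) (m : ℕ) :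
    HasBlockPsdLift S 2 m ↔ HasLorentzPowLift S m 2 := by
  refine ⟨fun h => h.hasLorentzPowLift_two, fun h => ?_⟩
  have h' := h.hasBlockPsdLift
  rwa [show max 1 (2 - 1) = 1 by norm_num, mul_one] at h'

/-- **Averkov 2019, Proposition 7, (iii) ⇒ (i)**: a lift by one second-order cone `L_m` is an SDP lift
with `2 × 2` blocks. [cite: Averkov2019, Prop. 7 (p05)] -/
theorem Averkov2019_prop7_iii_imp_i {E : Type*} [AddCommGroup E] [Module ℝ E] (S : Set E) :
    (∃ n, HasLorentzLift S n) → ∃ m, HasBlockPsdLift S 2 m := fun ⟨_, h⟩ => ⟨_, h.hasBlockPsdLift⟩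

/-! ### §4 Prop. 7 (i) ⇒ (iii) fails: the orthant `ℝ³_+` has no lift by a single second-order cone -/

/-- The nonnegative orthant of `ℝ³`. [folklore] -/
def orthantThree : Set (Fin 3 → ℝ) := {x | ∀ i, 0 ≤ x i}

/-- **`sxd(ℝ³_+) = 1 ≤ 2`**: the orthant is `{(M_0, M_1, M_2) : M_t ∈ S¹_+}`, an `(S¹_+)^3`-lift (a polyhedron).
[cite: Averkov2019, §2.1 (p05, "SDR(1) … is just the family of all polyhedra")] -/
theorem hasBlockPsdLift_orthantThree : HasBlockPsdLift orthantThree 1 3 := by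
  classical
  let π : (Fin 3 → Matrix (Fin 1) (Fin 1) ℝ) →ₗ[ℝ] (Fin 3 → ℝ) :=
    { toFun := fun M t => M t 0 0
      map_add' := fun M N => rfl
      map_smul' := fun c M => rfl }
  have hπ : ∀ M t, π M t = M t 0 0 := fun M t => rfl
  have h1 : ∀ M : Matrix (Fin 1) (Fin 1) ℝ, M = Matrix.diagonal fun _ => M 0 0 := fun M => by
    ext i j
    fin_cases i; fin_cases j
    rfl
  have hpsd : ∀ M : Matrix (Fin 1) (Fin 1) ℝ, M.PosSemidef ↔ 0 ≤ M 0 0 := fun M => by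
    rw [h1 M, Matrix.posSemidef_diagonal_iff]
    simp
  refine ⟨⊤, π, ?_⟩
  ext x
  simp only [orthantThree, Set.mem_setOf_eq, Set.mem_image, AffineSubspace.mem_top, and_true]
  constructor
  · intro hx
    refine ⟨fun t => Matrix.diagonal fun _ => x t, fun t => ?_, ?_⟩
    · rw [Matrix.posSemidef_diagonal_iff]; exact fun _ => hx t
    · funext t
      rw [hπ]
      rfl
  · rintro ⟨M, hM, rfl⟩ t
    rw [hπ]
    exact (hpsd (M t)).1 (hM t)

/-- **Interior points of `L` do not map to the boundary facet.** If `ℝ³_+ ⊇ π(L_{n+1} ∩ A)`, `q₀ ∈ L ∩ A`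
maps to a point with positive `0`-th coordinate and `q ∈ L ∩ A` maps into the facet `{x_0 = 0}`, then
`q ∈ ∂L`: `‖(q_0,…,q_{n−1})‖ = q_n`. [cite: Averkov2019, Prop. 7 (p05); elementary, this file] -/
theorem norm_hd_eq_of_apply_zero_eq_zero {A : AffineSubspace ℝ (Fin (n + 1) → ℝ)}
    {π : (Fin (n + 1) → ℝ) →ₗ[ℝ] (Fin 3 → ℝ)}
    (hsub : π '' (secondOrderConeSet n ∩ (A : Set (Fin (n + 1) → ℝ))) ⊆ orthantThree)
    {q₀ q : Fin (n + 1) → ℝ} (hq₀A : q₀ ∈ A) (hq₀π : 0 < π q₀ 0)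
    (hqL : q ∈ secondOrderConeSet n) (hqA : q ∈ A) (hqπ : π q 0 = 0) :
    ‖hd q‖ = q (Fin.last n) := by
  have hle : ‖hd q‖ ≤ q (Fin.last n) := (mem_secondOrderConeSet_iff_norm_hd q).1 hqL
  by_contra hne
  have hlt : ‖hd q‖ < q (Fin.last n) := lt_of_le_of_ne hle hne
  -- move `q` inside `A` away from `q₀`
  set D : ℝ := ‖hd (q - q₀)‖ + |(q - q₀) (Fin.last n)| + 1 with hD
  have hDpos : 0 < D := by positivity
  set ε : ℝ := (q (Fin.last n) - ‖hd q‖) / D with hε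
  have hεpos : 0 < ε := div_pos (sub_pos.2 hlt) hDpos
  have hεD : ε * D = q (Fin.last n) - ‖hd q‖ := div_mul_cancel₀ _ hDpos.ne'
  set q' : Fin (n + 1) → ℝ := ε • (q -ᵥ q₀) +ᵥ q with hq'
  have hq'A : q' ∈ A := A.smul_vsub_vadd_mem ε hqA hq₀A hqA
  have hq'eq : q' = ε • (q - q₀) + q := rfl
  have hq'L : q' ∈ secondOrderConeSet n := by
    rw [mem_secondOrderConeSet_iff_norm_hd]
    have e1 : hd q' = ε • hd (q - q₀) + hd q := rfl
    have n1 : ‖hd q'‖ ≤ ε * ‖hd (q - q₀)‖ + ‖hd q‖ := by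
      rw [e1]
      calc ‖ε • hd (q - q₀) + hd q‖ ≤ ‖ε • hd (q - q₀)‖ + ‖hd q‖ := norm_add_le _ _
        _ = ε * ‖hd (q - q₀)‖ + ‖hd q‖ := by rw [norm_smul, Real.norm_of_nonneg hεpos.le]
    have n2 : q' (Fin.last n) = ε * (q - q₀) (Fin.last n) + q (Fin.last n) := rfl
    have n3 : ε * -|(q - q₀) (Fin.last n)| ≤ ε * (q - q₀) (Fin.last n) :=
      mul_le_mul_of_nonneg_left (neg_abs_le _) hεpos.le
    have n4 : ε * (‖hd (q - q₀)‖ + |(q - q₀) (Fin.last n)|) ≤ ε * D :=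
      mul_le_mul_of_nonneg_left (by rw [hD]; linarith) hεpos.le
    rw [n2]
    linarith
  have hbad : 0 ≤ π q' 0 := hsub ⟨q', ⟨hq'L, hq'A⟩, rfl⟩ 0
  have hval : π q' 0 = -(ε * π q₀ 0) := by
    rw [hq'eq, map_add, map_smul, map_sub, Pi.add_apply, Pi.smul_apply, Pi.sub_apply, hqπ,
      smul_eq_mul]
    ring
  have : 0 < ε * π q₀ 0 := mul_pos hεpos hq₀π
  linarith

/-- **The orthant `ℝ³_+` has no lift by a single second-order cone `L_{n+1}`, for any `n`** — a
counterexample to (i) ⇒ (iii) of Averkov's Proposition 7 as printed. [cite: Averkov2019, Prop. 7 (p05); refuted as printed, this file] -/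
theorem not_hasLorentzLift_orthantThree (n : ℕ) : ¬ HasLorentzLift orthantThree n := by
  rintro ⟨A, π, hS⟩
  have hsub : π '' (secondOrderConeSet n ∩ (A : Set (Fin (n + 1) → ℝ))) ⊆ orthantThree := hS ▸ subset_rfl
  have hsurj : ∀ x ∈ orthantThree, ∃ q, q ∈ secondOrderConeSet n ∧ q ∈ A ∧ π q = x := by
    intro x hx
    rw [hS] at hx
    obtain ⟨q, ⟨h1, h2⟩, h3⟩ := hx
    exact ⟨q, h1, h2, h3⟩
  -- preimages of `(1,1,1)`, `e_1`, `e_2`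
  obtain ⟨q₀, hq₀L, hq₀A, hq₀⟩ := hsurj (fun _ => 1) (fun _ => zero_le_one)
  obtain ⟨q₁, hq₁L, hq₁A, hq₁⟩ := hsurj (Pi.single 1 1) (fun i => by
    by_cases h : i = 1 <;> simp [h])
  obtain ⟨q₂, hq₂L, hq₂A, hq₂⟩ := hsurj (Pi.single 2 1) (fun i => by
    by_cases h : i = 2 <;> simp [h])
  have hq₀π : 0 < π q₀ 0 := by rw [hq₀]; exact zero_lt_one
  have hb₁ : ‖hd q₁‖ = q₁ (Fin.last n) :=
    norm_hd_eq_of_apply_zero_eq_zero hsub hq₀A hq₀π hq₁L hq₁A (by rw [hq₁]; simp)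
  have hb₂ : ‖hd q₂‖ = q₂ (Fin.last n) :=
    norm_hd_eq_of_apply_zero_eq_zero hsub hq₀A hq₀π hq₂L hq₂A (by rw [hq₂]; simp)
  -- the midpoint
  set m : Fin (n + 1) → ℝ := (2 : ℝ)⁻¹ • (q₂ -ᵥ q₁) +ᵥ q₁ with hm
  have hmA : m ∈ A := A.smul_vsub_vadd_mem _ hq₂A hq₁A hq₁A
  have hmeq : m = (2 : ℝ)⁻¹ • q₁ + (2 : ℝ)⁻¹ • q₂ := by
    rw [hm, vsub_eq_sub, vadd_eq_add]
    module
  have hdm : hd m = (2 : ℝ)⁻¹ • (hd q₁ + hd q₂) := by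
    rw [hmeq, smul_add]
    rfl
  have hml : m (Fin.last n) = (2 : ℝ)⁻¹ * (q₁ (Fin.last n) + q₂ (Fin.last n)) := by
    rw [hmeq, Pi.add_apply, Pi.smul_apply, Pi.smul_apply, smul_eq_mul, smul_eq_mul]
    ring
  have hmL : m ∈ secondOrderConeSet n := by
    rw [mem_secondOrderConeSet_iff_norm_hd, hdm, hml, norm_smul, Real.norm_of_nonneg (by norm_num)]
    have := norm_add_le (hd q₁) (hd q₂)
    nlinarith
  have hmπ : π m 0 = 0 := by
    rw [hmeq, map_add, map_smul, map_smul, hq₁, hq₂]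
    simp
  have hbm : ‖hd m‖ = m (Fin.last n) := norm_hd_eq_of_apply_zero_eq_zero hsub hq₀A hq₀π hmL hmA hmπ
  -- equality in the triangle inequality
  have hadd : ‖hd q₁ + hd q₂‖ = ‖hd q₁‖ + ‖hd q₂‖ := by
    rw [hdm, hml, norm_smul, Real.norm_of_nonneg (by norm_num), ← hb₁, ← hb₂] at hbm
    linarith
  have hray : SameRay ℝ (hd q₁) (hd q₂) := sameRay_iff_norm_add.2 hadd
  -- a vector on `∂L` with zero head is zero, and `π 0 ≠ e_i`
  have hzero : ∀ {q : Fin (n + 1) → ℝ} {x : Fin 3 → ℝ}, ‖hd q‖ = q (Fin.last n) → hd q = 0 →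
      π q = x → x = 0 := by
    intro q x hb h0 hπ
    have hq : q = 0 := by
      funext i
      refine Fin.lastCases ?_ (fun j => ?_) i
      · rw [← hb, h0, norm_zero]; rfl
      · have := congrArg (fun v : EuclideanSpace ℝ (Fin n) => v j) h0
        simpa [hd_apply] using this
    rw [← hπ, hq, map_zero]
  rcases hray with h0 | h0 | ⟨r₁, r₂, hr₁, hr₂, hr⟩
  · have := congrFun (hzero hb₁ h0 hq₁) 1
    simp at this
  · have := congrFun (hzero hb₂ h0 hq₂) 2
    simp at this
  · -- `r₁ q₁ = r₂ q₂`, so `r₁ e₁ = r₂ e₂`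
    have hl : r₁ * q₁ (Fin.last n) = r₂ * q₂ (Fin.last n) := by
      have h := congrArg (fun v => ‖v‖) hr
      simp only [norm_smul, Real.norm_of_nonneg hr₁.le, Real.norm_of_nonneg hr₂.le, hb₁, hb₂] at h
      exact h
    have hvec : r₁ • q₁ = r₂ • q₂ := by
      funext i
      refine Fin.lastCases ?_ (fun j => ?_) i
      · simpa using hl
      · have := congrArg (fun v : EuclideanSpace ℝ (Fin n) => v j) hr
        simpa [hd_apply] using this
    have h := congrArg π hvec
    rw [map_smul, map_smul, hq₁, hq₂] at h
    have h1 := congrFun h 1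
    simp at h1
    exact absurd h1 hr₁.ne'

/-- **Averkov 2019, Proposition 7, (i) ⇒ (iii) REFUTED as printed**: it is not true that every set with
`sxd(S) ≤ 2` has an `L_m`-lift for some `m` — the orthant `ℝ³_+` (`sxd = 1`) has none. The correct
third condition is a lift by a finite PRODUCT of second-order cones (`HasLorentzPowLift`;
`Averkov2019_prop7_i_iff_ii`), which is what [Fawzi2016] calls a second-order cone lift and what the
rest of [Averkov2019] uses. [cite: Averkov2019, Prop. 7 (p05)] [cite: Fawzi2016, §1 (p03)] -/
theorem Averkov2019_prop7_iii_false :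
    ¬ ∀ S : Set (Fin 3 → ℝ), (∃ m, HasBlockPsdLift S 2 m) → ∃ n, HasLorentzLift S n := by
  intro h
  obtain ⟨n, hn⟩ := h orthantThree ⟨3, hasBlockPsdLift_orthantThree.mono_size (by norm_num)⟩
  exact not_hasLorentzLift_orthantThree n hn

/-- The corrected equivalence in full: `sxd(S) ≤ 2` ⟺ `S` has a `(L_3)^m`-lift ⟺ `S` has an
`(L_{n+1})^p`-lift for some `n, p` (single cones `L_{n+1}` included as `p = 1`, but not sufficient).
[cite: Averkov2019, Prop. 7 (p05)] [cite: Fawzi2016, §1 (p03)] -/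
theorem Averkov2019_prop7_corrected {E : Type*} [AddCommGroup E] [Module ℝ E] (S : Set E) :
    ((∃ m, HasBlockPsdLift S 2 m) ↔ ∃ m, HasLorentzPowLift S m 2) ∧
      ((∃ m, HasBlockPsdLift S 2 m) ↔ ∃ p n, HasLorentzPowLift S p n) := by
  refine ⟨⟨fun ⟨m, h⟩ => ⟨m, h.hasLorentzPowLift_two⟩, fun ⟨m, h⟩ => ⟨m, (Averkov2019_prop7_i_iff_ii S m).2 h⟩⟩,
    ⟨fun ⟨m, h⟩ => ⟨m, 2, h.hasLorentzPowLift_two⟩, fun ⟨p, n, h⟩ => ⟨_, h.hasBlockPsdLift⟩⟩⟩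

end SecondOrderConeLift

end Literature.Combinatorics.Optimization
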